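import Literature.MathematicalPhysics.QuantumManyBody.BoseGasLineSineGap
import Literature.MathematicalPhysics.QuantumManyBody.BoseGasWallCutoff
import HarnessLib

/-!
# The free Dirichlet gap with a slab term, on configuration space

Topic `Literature/MathematicalPhysics/QuantumManyBody`, namespace `…BoseGas`; lifts the
one-dimensional inequalities of `BoseGasLineSineGap.lean` (`line_poincare`, `line_gap_slab`) to
Dirichlet trial states of `N` particles in the box `Λ_L` along the coordinate lines of
`BoseGasHardCoreContact.lean` (`linePoint`, `lintegral_le_of_forall_line`):

* `ofReal_mul_card_le_directionalEnergy` — `λ N ≤ T_b := ∑ⱼ ∫ |∂_{j,b}Φ|²` for every direction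
  `b` (`λ = (π/L)²`, `‖Φ‖ = 1`);
* `slab_gap_config` — for `0 < s ≤ L` and a direction `a`,
  `3λ ∑ⱼ ∫_{x_{j,a} > L-s} |Φ|² + 2λN ≤ (4π²s³/L³)λ N + 2 T_a`;
* `sum_directionalEnergy_eq` — `∑_b T_b = ∫ |∇Φ|²` (`≤ ⟨Φ, HΦ⟩`).

Hence `3λ · #{particles within s of the wall} ≤ 2(∫|∇Φ|² - 3λN) + (4π²s³/L³)λN`: the slab
occupation of a state of the free Dirichlet gas is controlled by its kinetic energy above the
ground level `3λN` [LSSY2005, Ch. 2 (2.3)].  No definitions.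

## References

* [LSSY2005] E. H. Lieb, R. Seiringer, J. P. Solovej, J. Yngvason, *The Mathematics of the Bose
  Gas and its Condensation* (2005), Ch. 2, (2.3) and after (2.50).
-/

noncomputable section

namespace Literature.MathematicalPhysics.QuantumManyBody.BoseGas

open _root_.MeasureTheory _root_.Filter _root_.Set _root_.Real
open scoped ENNReal NNReal Topology BigOperators

variable {N : ℕ} {L : ℝ}

/-- **A coordinate line of a Dirichlet trial state.**  Along the line through `X` parallel to
`e_{j,a}`, `t ↦ Φ(γ(t))` is `C¹` with derivative `∂_{j,a}Φ(γ(t))`, both continuous, and vanishes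
for `t ∉ (0, L)`. [folklore] -/
theorem line_data (Φ : TrialState N L) (j : Fin N) (a : Fin 3) (X : Config N) (y : Fin 3 → ℝ) :
    (∀ t, HasDerivAt (fun t => Φ.ψ (linePoint X j y a t))
        (fderiv ℝ Φ.ψ (linePoint X j y a t) (unitVec j a)) t) ∧
      Continuous (fun t => Φ.ψ (linePoint X j y a t)) ∧
      Continuous (fun t => fderiv ℝ Φ.ψ (linePoint X j y a t) (unitVec j a)) ∧
      ∀ t, t ∉ Ioo 0 L → Φ.ψ (linePoint X j y a t) = 0 := by
  have hγeq : linePoint X j y a = fun t => linePoint X j y a 0 + t • unitVec j a :=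
    funext fun t => linePoint_eq_add_smul X j y a t
  have hγcont : Continuous (linePoint X j y a) := continuous_linePoint X j y a
  refine ⟨fun t => ?_, Φ.contDiff.continuous.comp hγcont,
    ((Φ.contDiff.continuous_fderiv one_ne_zero).comp hγcont).clm_apply continuous_const,
    fun t ht => ?_⟩
  · have hline : HasDerivAt (fun r : ℝ => linePoint X j y a 0 + r • unitVec j a) (unitVec j a) t := by
      simpa using ((hasDerivAt_id t).smul_const (unitVec j a)).const_add (linePoint X j y a 0)
    have hψd : HasFDerivAt Φ.ψ (fderiv ℝ Φ.ψ (linePoint X j y a t))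
        (linePoint X j y a 0 + t • unitVec j a) := by
      rw [← linePoint_eq_add_smul]; exact (Φ.contDiff.differentiable one_ne_zero _).hasFDerivAt
    have hcomp := hψd.comp_hasDerivAt t hline
    have hfun : (Φ.ψ ∘ fun r : ℝ => linePoint X j y a 0 + r • unitVec j a) =
        fun t => Φ.ψ (linePoint X j y a t) := by
      funext r; simp [← linePoint_eq_add_smul]
    rwa [hfun] at hcomp
  · refine Φ.eq_zero _ fun hX => ht ?_
    have := hX j a
    rwa [linePoint_apply_self_self] at this

/-- Integrals along a line of a function vanishing off `(0, L)` live on `(0, L]`. [folklore] -/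
theorem lintegral_eq_setLIntegral_Ioc_of_zero {φ : ℝ → ℂ} (hzero : ∀ t, t ∉ Ioo 0 L → φ t = 0) :
    ∫⁻ t, ‖φ t‖ₑ ^ 2 = ∫⁻ t in Ioc 0 L, ‖φ t‖ₑ ^ 2 := by
  rw [← lintegral_add_compl (fun t => ‖φ t‖ₑ ^ 2) measurableSet_Ioc,
    setLIntegral_eq_zero measurableSet_Ioc.compl fun t ht => ?_, add_zero]
  have : t ∉ Ioo 0 L := fun h => ht ⟨h.1, h.2.le⟩
  simp [hzero t this]

/-- The slab part of a line integral of a function vanishing off `(0, L)`. [folklore] -/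
theorem lintegral_indicator_Ioi_le_setLIntegral_Ioc {φ : ℝ → ℂ} (hzero : ∀ t, t ∉ Ioo 0 L → φ t = 0)
    (c : ℝ) :
    ∫⁻ t, (Ioi c).indicator (fun t => ‖φ t‖ₑ ^ 2) t ≤ ∫⁻ t in Ioc c L, ‖φ t‖ₑ ^ 2 := by
  rw [lintegral_indicator measurableSet_Ioi]
  have hsub : Ioi c ⊆ Ioc c L ∪ Ioi L := fun t ht => by
    by_cases h : t ≤ L
    · exact Or.inl ⟨ht, h⟩
    · exact Or.inr (not_le.1 h)
  refine (lintegral_mono_set hsub).trans ((lintegral_union_le _ _ _).trans ?_)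
  rw [setLIntegral_eq_zero measurableSet_Ioi fun t ht => ?_, add_zero]
  have : t ∉ Ioo 0 L := fun h => (lt_irrefl L) (lt_trans ht h.2)
  simp [hzero t this]

/-- **The ground level in one direction**: for a Dirichlet trial state `Φ` of `Λ_L` (`L > 0`) and
any direction `b`, `(π/L)² N ≤ ∑ⱼ ∫ |∂_{j,b}Φ|²`. [cite: LSSY2005, Ch. 2 (2.3)] -/
theorem ofReal_mul_card_le_directionalEnergy (hL : 0 < L) (Φ : TrialState N L) (b : Fin 3) :
    ENNReal.ofReal ((π / L) ^ 2) * N ≤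
      ∑ j : Fin N, ∫⁻ X, (‖fderiv ℝ Φ.ψ X (unitVec j b)‖₊ : ℝ≥0∞) ^ 2 := by
  have hj : ∀ j : Fin N, ENNReal.ofReal ((π / L) ^ 2) * ∫⁻ X, ((‖Φ.ψ X‖₊ : ℝ≥0∞)) ^ 2 ≤
      ∫⁻ X, (‖fderiv ℝ Φ.ψ X (unitVec j b)‖₊ : ℝ≥0∞) ^ 2 := by
    intro j
    rw [← lintegral_const_mul _ (measurable_ennnormSq Φ.contDiff.continuous)]
    refine lintegral_le_of_forall_line j b ((measurable_ennnormSq Φ.contDiff.continuous).const_mul _)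
      (measurable_ennnormSq_fderiv_apply Φ.contDiff _) fun X y => ?_
    obtain ⟨hder, hcont, hcont', hzero⟩ := line_data Φ j b X y
    have h0 : Φ.ψ (linePoint X j y b 0) = 0 := hzero 0 fun h => (lt_irrefl (0 : ℝ)) h.1
    have hL0 : Φ.ψ (linePoint X j y b L) = 0 := hzero L fun h => (lt_irrefl L) h.2
    have h1d := line_poincare hL (fun t _ => hder t) hcont hcont' h0 hL0
    have hmline : Measurable fun t => ((‖Φ.ψ (linePoint X j y b t)‖₊ : ℝ≥0∞)) ^ 2 :=
      (measurable_ennnormSq Φ.contDiff.continuous).comp (continuous_linePoint X j y b).measurable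
    rw [lintegral_const_mul _ hmline]
    calc ENNReal.ofReal ((π / L) ^ 2) * ∫⁻ t, ((‖Φ.ψ (linePoint X j y b t)‖₊ : ℝ≥0∞)) ^ 2
        = ENNReal.ofReal ((π / L) ^ 2) * ∫⁻ t in Ioc 0 L, ‖Φ.ψ (linePoint X j y b t)‖ₑ ^ 2 := by
          rw [← lintegral_eq_setLIntegral_Ioc_of_zero hzero]; rfl
      _ ≤ ∫⁻ t in Ioc 0 L, ‖fderiv ℝ Φ.ψ (linePoint X j y b t) (unitVec j b)‖ₑ ^ 2 := h1d
      _ ≤ ∫⁻ t, (‖fderiv ℝ Φ.ψ (linePoint X j y b t) (unitVec j b)‖₊ : ℝ≥0∞) ^ 2 :=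
          setLIntegral_le_lintegral _ _
  calc ENNReal.ofReal ((π / L) ^ 2) * N
      = ∑ j : Fin N, ENNReal.ofReal ((π / L) ^ 2) * ∫⁻ X, ((‖Φ.ψ X‖₊ : ℝ≥0∞)) ^ 2 := by
        rw [Φ.norm_eq, mul_one, Finset.sum_const, Finset.card_univ, Fintype.card_fin, nsmul_eq_mul,
          mul_comm]
    _ ≤ _ := Finset.sum_le_sum fun j _ => hj j

/-- **The free gap with a slab term, on configuration space.**  For a Dirichlet trial state `Φ`
of `Λ_L` (`L > 0`), a direction `a` and `0 < s ≤ L`, with `λ = (π/L)²`: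
`3λ ∑ⱼ ∫_{x_{j,a} > L-s} |Φ|² + 2λN ≤ (4π²s³/L³) λ N + 2 ∑ⱼ ∫ |∂_{j,a}Φ|²`.
[cite: LSSY2005, Ch. 2, (2.3) and after (2.50)] -/
theorem slab_gap_config (hL : 0 < L) (Φ : TrialState N L) (a : Fin 3) {s : ℝ} (hs : 0 < s)
    (hsL : s ≤ L) :
    ENNReal.ofReal (3 * (π / L) ^ 2) *
        (∑ j : Fin N, ∫⁻ X in {X : Config N | L - s < X j a}, ((‖Φ.ψ X‖₊ : ℝ≥0∞)) ^ 2) +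
        ENNReal.ofReal (2 * (π / L) ^ 2) * N ≤
      ENNReal.ofReal (4 * π ^ 2 * s ^ 3 / L ^ 3 * (π / L) ^ 2) * N +
        2 * ∑ j : Fin N, ∫⁻ X, (‖fderiv ℝ Φ.ψ X (unitVec j a)‖₊ : ℝ≥0∞) ^ 2 := by
  set lam : ℝ := (π / L) ^ 2 with hlam
  set κ : ℝ := 4 * π ^ 2 * s ^ 3 / L ^ 3 * lam with hκ
  have hmΦ : Measurable fun X : Config N => ((‖Φ.ψ X‖₊ : ℝ≥0∞)) ^ 2 :=
    measurable_ennnormSq Φ.contDiff.continuous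
  -- one particle at a time
  have hj : ∀ j : Fin N,
      ENNReal.ofReal (3 * lam) * (∫⁻ X in {X : Config N | L - s < X j a}, ((‖Φ.ψ X‖₊ : ℝ≥0∞)) ^ 2) +
          ENNReal.ofReal (2 * lam) * ∫⁻ X, ((‖Φ.ψ X‖₊ : ℝ≥0∞)) ^ 2 ≤
        ENNReal.ofReal κ * (∫⁻ X, ((‖Φ.ψ X‖₊ : ℝ≥0∞)) ^ 2) +
          2 * ∫⁻ X, (‖fderiv ℝ Φ.ψ X (unitVec j a)‖₊ : ℝ≥0∞) ^ 2 := by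
    intro j
    have hS := measurableSet_coordWall (N := N) (L - s) j a
    set F : Config N → ℝ≥0∞ := fun X => ENNReal.ofReal (3 * lam) *
      {X : Config N | L - s < X j a}.indicator (fun X => ((‖Φ.ψ X‖₊ : ℝ≥0∞)) ^ 2) X +
        ENNReal.ofReal (2 * lam) * ((‖Φ.ψ X‖₊ : ℝ≥0∞)) ^ 2 with hF
    set G : Config N → ℝ≥0∞ := fun X => ENNReal.ofReal κ * ((‖Φ.ψ X‖₊ : ℝ≥0∞)) ^ 2 +
      2 * (‖fderiv ℝ Φ.ψ X (unitVec j a)‖₊ : ℝ≥0∞) ^ 2 with hG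
    have hmI : Measurable fun X => {X : Config N | L - s < X j a}.indicator
        (fun X => ((‖Φ.ψ X‖₊ : ℝ≥0∞)) ^ 2) X := hmΦ.indicator hS
    have hmD : Measurable fun X => (‖fderiv ℝ Φ.ψ X (unitVec j a)‖₊ : ℝ≥0∞) ^ 2 :=
      measurable_ennnormSq_fderiv_apply Φ.contDiff _
    have hFm : Measurable F := (hmI.const_mul _).add (hmΦ.const_mul _)
    have hGm : Measurable G := (hmΦ.const_mul _).add (hmD.const_mul _)
    have hFint : ∫⁻ X, F X = ENNReal.ofReal (3 * lam) *
        (∫⁻ X in {X : Config N | L - s < X j a}, ((‖Φ.ψ X‖₊ : ℝ≥0∞)) ^ 2) +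
          ENNReal.ofReal (2 * lam) * ∫⁻ X, ((‖Φ.ψ X‖₊ : ℝ≥0∞)) ^ 2 := by
      simp only [hF]
      rw [lintegral_add_left (hmI.const_mul _), lintegral_const_mul _ hmI, lintegral_const_mul _ hmΦ,
        lintegral_indicator hS]
    have hGint : ∫⁻ X, G X = ENNReal.ofReal κ * (∫⁻ X, ((‖Φ.ψ X‖₊ : ℝ≥0∞)) ^ 2) +
        2 * ∫⁻ X, (‖fderiv ℝ Φ.ψ X (unitVec j a)‖₊ : ℝ≥0∞) ^ 2 := by
      simp only [hG]
      rw [lintegral_add_left (hmΦ.const_mul _), lintegral_const_mul _ hmΦ, lintegral_const_mul _ hmD]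
    rw [← hFint, ← hGint]
    refine lintegral_le_of_forall_line j a hFm hGm fun X y => ?_
    obtain ⟨hder, hcont, hcont', hzero⟩ := line_data Φ j a X y
    set φ : ℝ → ℂ := fun t => Φ.ψ (linePoint X j y a t) with hφ
    set φ' : ℝ → ℂ := fun t => fderiv ℝ Φ.ψ (linePoint X j y a t) (unitVec j a) with hφ'
    have h0 : φ 0 = 0 := hzero 0 fun h => (lt_irrefl (0 : ℝ)) h.1
    have hL0 : φ L = 0 := hzero L fun h => (lt_irrefl L) h.2
    have h1d := line_gap_slab hL (fun t _ => hder t) hcont hcont' h0 hL0 hs.le hsL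
    -- the left side along the line
    have hind : ∀ t, {X : Config N | L - s < X j a}.indicator (fun X => ((‖Φ.ψ X‖₊ : ℝ≥0∞)) ^ 2)
        (linePoint X j y a t) = (Ioi (L - s)).indicator (fun t => ‖φ t‖ₑ ^ 2) t := by
      intro t
      by_cases ht : L - s < t
      · rw [indicator_of_mem (show linePoint X j y a t ∈ {X : Config N | L - s < X j a} by
          simpa [linePoint_apply_self_self] using ht), indicator_of_mem (show t ∈ Ioi (L - s) from ht)]
        rfl
      · rw [indicator_of_notMem (show linePoint X j y a t ∉ {X : Config N | L - s < X j a} by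
          simpa [linePoint_apply_self_self] using ht), indicator_of_notMem (show t ∉ Ioi (L - s) from ht)]
    have hmφ : Measurable fun t => ‖φ t‖ₑ ^ 2 := (hcont.measurable.enorm).pow_const 2
    have hmφ' : Measurable fun t => ‖φ' t‖ₑ ^ 2 := (hcont'.measurable.enorm).pow_const 2
    have hLHS : ∫⁻ t, F (linePoint X j y a t) ≤
        ENNReal.ofReal (3 * lam) * (∫⁻ t in Ioc (L - s) L, ‖φ t‖ₑ ^ 2) +
          ENNReal.ofReal (2 * lam) * ∫⁻ t in Ioc 0 L, ‖φ t‖ₑ ^ 2 := by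
      have hmI1 : Measurable fun t => (Ioi (L - s)).indicator (fun t => ‖φ t‖ₑ ^ 2) t :=
        hmφ.indicator measurableSet_Ioi
      have hsplit : ∫⁻ t, F (linePoint X j y a t) =
          ENNReal.ofReal (3 * lam) * (∫⁻ t, (Ioi (L - s)).indicator (fun t => ‖φ t‖ₑ ^ 2) t) +
            ENNReal.ofReal (2 * lam) * ∫⁻ t, ‖φ t‖ₑ ^ 2 := by
        have hmline2 : Measurable fun t => ((‖Φ.ψ (linePoint X j y a t)‖₊ : ℝ≥0∞)) ^ 2 :=
          hmΦ.comp (continuous_linePoint X j y a).measurable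
        simp only [hF, hind]
        rw [lintegral_add_left (hmI1.const_mul _), lintegral_const_mul _ hmI1,
          lintegral_const_mul _ hmline2]
        rfl
      rw [hsplit, lintegral_eq_setLIntegral_Ioc_of_zero hzero]
      exact add_le_add (mul_le_mul_right (lintegral_indicator_Ioi_le_setLIntegral_Ioc hzero _) _) le_rfl
    have hRHS : ENNReal.ofReal κ * (∫⁻ t in Ioc 0 L, ‖φ t‖ₑ ^ 2) + 2 * ∫⁻ t in Ioc 0 L, ‖φ' t‖ₑ ^ 2 ≤
        ∫⁻ t, G (linePoint X j y a t) := by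
      have hsplit : ∫⁻ t, G (linePoint X j y a t) =
          ENNReal.ofReal κ * (∫⁻ t, ‖φ t‖ₑ ^ 2) + 2 * ∫⁻ t, ‖φ' t‖ₑ ^ 2 := by
        simp only [hG]
        change ∫⁻ t, (ENNReal.ofReal κ * ‖φ t‖ₑ ^ 2 + 2 * ‖φ' t‖ₑ ^ 2) = _
        rw [lintegral_add_left (hmφ.const_mul _), lintegral_const_mul _ hmφ, lintegral_const_mul _ hmφ']
      rw [hsplit]
      exact add_le_add (mul_le_mul_right (setLIntegral_le_lintegral _ _) _)
        (mul_le_mul_right (setLIntegral_le_lintegral _ _) _)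
    exact hLHS.trans (h1d.trans hRHS)
  -- sum over the particles
  have hB : (N : ℝ≥0∞) = ∑ _j : Fin N, ∫⁻ X, ((‖Φ.ψ X‖₊ : ℝ≥0∞)) ^ 2 := by
    rw [Φ.norm_eq, Finset.sum_const, Finset.card_univ, Fintype.card_fin, nsmul_eq_mul, mul_one]
  calc ENNReal.ofReal (3 * lam) *
        (∑ j : Fin N, ∫⁻ X in {X : Config N | L - s < X j a}, ((‖Φ.ψ X‖₊ : ℝ≥0∞)) ^ 2) +
        ENNReal.ofReal (2 * lam) * N
      = ∑ j : Fin N, (ENNReal.ofReal (3 * lam) *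
          (∫⁻ X in {X : Config N | L - s < X j a}, ((‖Φ.ψ X‖₊ : ℝ≥0∞)) ^ 2) +
            ENNReal.ofReal (2 * lam) * ∫⁻ X, ((‖Φ.ψ X‖₊ : ℝ≥0∞)) ^ 2) := by
        rw [hB, Finset.mul_sum, Finset.mul_sum, ← Finset.sum_add_distrib]
    _ ≤ ∑ j : Fin N, (ENNReal.ofReal κ * (∫⁻ X, ((‖Φ.ψ X‖₊ : ℝ≥0∞)) ^ 2) +
          2 * ∫⁻ X, (‖fderiv ℝ Φ.ψ X (unitVec j a)‖₊ : ℝ≥0∞) ^ 2) := Finset.sum_le_sum fun j _ => hj j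
    _ = ENNReal.ofReal κ * N + 2 * ∑ j : Fin N, ∫⁻ X, (‖fderiv ℝ Φ.ψ X (unitVec j a)‖₊ : ℝ≥0∞) ^ 2 := by
        rw [Finset.sum_add_distrib, ← Finset.mul_sum, ← Finset.mul_sum, ← hB]

/-- **The directional energies add up to the kinetic energy**: `∑_b ∑ⱼ ∫|∂_{j,b}Φ|² = ∫|∇Φ|²`.
[folklore] -/
theorem sum_directionalEnergy_eq {ψ : Config N → ℂ} (hψ : ContDiff ℝ 1 ψ) :
    ∑ b : Fin 3, ∑ j : Fin N, ∫⁻ X, (‖fderiv ℝ ψ X (unitVec j b)‖₊ : ℝ≥0∞) ^ 2 =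
      ∫⁻ X, kineticDensity ψ X := by
  rw [Finset.sum_comm]
  unfold kineticDensity
  rw [lintegral_finsetSum Finset.univ fun i _ => Finset.measurable_sum Finset.univ fun k _ =>
    measurable_ennnormSq_fderiv_apply hψ _]
  refine Finset.sum_congr rfl fun i _ => ?_
  rw [lintegral_finsetSum Finset.univ fun k _ => measurable_ennnormSq_fderiv_apply hψ _]

end Literature.MathematicalPhysics.QuantumManyBody.BoseGas

end
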